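import Summits.Ventures.GridStability.Models.InverterDVOCNetwork
import Literature.MathematicalPhysics.PowerSystems.DVOCReducedNetworkLyapunov

/-!
# GridStability/Models/InverterDVOCReducedBridge — RULING 18 / PARTITION A20 in the kernel: the printed reduced dVOC model (17) IS the Summits-side `DvocNetwork` field

Cell `gridfusion` (LADDER-GRIDFUSION, APEX LINE rung G3.c, director RULING 18 = lead A20: «TRACK T …
reduced model (17) = model-3's InverterDVOCNetwork field»); seat gridfusion-model-3 (g3).
Companion of model-3's `Models/InverterDVOCNetwork.lean` (p465594: `DvocNetwork N`, set-point /
admittance form `f^s(v̂) = η(𝒦v̂ − ℛ(κ)𝒴v̂ + η_a Φ(v̂)v̂)` of [cite: SuboticEtAl2021, eq. (ss.f.vhat)])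
and of lit-2's `Literature/MathematicalPhysics/PowerSystems/DVOCReducedNetworkLyapunov.lean`
(p475771: `DvocReduced N`, PHASE-ERROR form `f(v) = η(e_θ(v) + αΦ(v)v)` of
[cite: GrossEtAl2019, eq. (17)] with the printed Lyapunov function (19) and Proposition 3 (25)).
The two typings were made with the same state convention `(x, y) : (Fin N → ℝ) × (Fin N → ℝ)`;
what is NOT definitional is the parametrisation: (set-points `p_k*, q_k*`, admittance blocks
`𝒴_{kj} = Yre_{kj} I₂ + Yim_{kj} J`, gains `η, η_a, κ`) versus (steady-state angles `θ_k`, edge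
weights `‖Y_jk‖`, gains `η, α`). This file proves the identity of the two vector fields under
EXACTLY the two printed hypotheses that relate them, and packages the class inclusion.

THREE COLUMNS. MODELLED column only: (H-Y) «`ℛ(κ) i^s_o(v) = 𝓛 v`» — the rotated quasi-steady-state
network current is the extended Laplacian of the edge weights, i.e. `𝒴 = L ⊗ R(−κ)`, which is
[cite: GrossEtAl2019, Assumption 1] (uniform `ℓ/r` ratio, `κ = tan⁻¹(ω₀ρ)`,
`Z_l⁻¹ = ‖Y_l‖ R(−κ)`) for a network of `r–ℓ` lines WITHOUT shunt elements; (H-pq) the set-points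
are CONSISTENT, `p_k* = Σ_j p_jk*`, `q_k* = Σ_j q_jk*` with the branch powers (36)
[cite: GrossEtAl2019, Condition 1, Prop. 1]. Under (H-Y)+(H-pq) and equal gains
(`η = η`, `η_a = α`, same `κ`, same `v_k* ≠ 0`): `DvocNetwork.field = DvocReduced.field`
(`field_eq_reduced_field`); conversely EVERY `DvocReduced` record is a `DvocNetwork`
(`ofReduced`, `ofReduced_field`: `Yre = cos κ · L`, `Yim = −sin κ · L`, `p* := pSet`, `q* := qSet`).
Consequences typed: solutions coincide (`isSolutionOn_iff_reduced`), and lit-2's Proposition 3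
`dV/dt ≤ −α₁ψ(v)² ≤ 0` holds along `DvocNetwork` solutions (`hasDerivWithinAt_V_le_of_field_eq`) —
so the Track-T analytic certificate (instance hypotheses `DecreaseOnS c`, `PhaseErrorBound κ₀`,
sos-1/ref-1) and the Track-S SOS/quotient certificate (sos-3, `InverterDVOCQuotient.lean`) are
statements about ONE kernel object whenever the instance satisfies (H-Y)+(H-pq). CERTIFIED /
VALIDATED: nothing here. No sentence of this file says a converter or a grid is stable.

INSTANCE CAVEAT (declared, never silent; MODEL-VALIDITY MV-κ): for the instance of record
«DVOC2-GCBD19-13» / D1 (model-4, `bench/data/DVOC-GCBD19/`) the CONTROLLER angle is the rational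
circle point `κ′ = 2·atan(381/421)` while the printed lines have `x/r = 10` exactly, so (H-Y) holds
for `κ′` only up to the declared `|κ′ − tan⁻¹10| ≈ 6.2·10⁻⁷ rad`; (H-Y) holds EXACTLY (with all of
`cos κ′ = 16040/161201`, `sin κ′ = 160401/161201`, `‖Y_l‖ = 16040/(161201·r_l)` RATIONAL) for the
plant variant `x′/r := tan κ′ = 160401/16040` (relative change `6.2·10⁻⁶` of the one-digit printed
`0.3 Ω/km`). Which reading a Bench file certifies is the lead's ruling; this file is parametric.
-/

noncomputable section

open Real Finset
open Literature.MathematicalPhysics.PowerSystems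

namespace Summit.Ventures.GridStability.Models.InverterDVOC.DvocNetwork

variable {N : ℕ}

/-! ## §1 The weighted Laplacian of the printed edge weights and hypothesis (H-Y) -/

/-- Entries `L_{kj}` of the weighted Laplacian `L = B diag(‖Y_l‖) Bᵀ` of lit-2's edge weights
`w k j = ‖Y_jk‖` [cite: GrossEtAl2019, §II-B]: `L_{kk} = Σ_i w_{ki}`, `L_{kj} = −w_{kj}` (`j ≠ k`)
(a diagonal weight `w k k`, if any, cancels). MODELLED column. -/
def lapMat (D : DvocReduced N) (k j : Fin N) : ℝ := (if j = k then ∑ i, D.w k i else 0) - D.w k j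

/-- `Σ_j L_{kj} x_j = Σ_j ‖Y_jk‖ (x_k − x_j)` — the Laplacian acts as lit-2's `lap`. [folklore] -/
theorem sum_lapMat_mul (D : DvocReduced N) (k : Fin N) (x : Fin N → ℝ) :
    ∑ j, lapMat D k j * x j = ∑ j, D.w k j * (x k - x j) := by
  simp only [lapMat, sub_mul, Finset.sum_sub_distrib, ite_mul, zero_mul, Finset.sum_ite_eq',
    Finset.mem_univ, if_true, mul_sub, Finset.sum_mul]

/-- **(H-Y) from admittance data.** If the admittance blocks are `𝒴_{kj} = L_{kj} R(−κ)`, i.e.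
`Yre = cos κ · L`, `Yim = −sin κ · L` ([cite: GrossEtAl2019, Assumption 1]: `Z_l⁻¹ = ‖Y_l‖ R(−κ)`
for every line, no shunts), then the rotated network current `ℛ(κ)(𝒴v̂)_k` of the Summits model is
the extended Laplacian `(𝓛 v̂)_k` of lit-2's typing, both components. [cite: GrossEtAl2019, §IV-C] -/
theorem rot_netCur_eq_lap (W : DvocNetwork N) (D : DvocReduced N)
    (hYre : ∀ k j, W.Yre k j = cos W.κ * lapMat D k j)
    (hYim : ∀ k j, W.Yim k j = -(sin W.κ * lapMat D k j)) (v : State N) (k : Fin N) :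
    cos W.κ * W.netCur₁ v k - sin W.κ * W.netCur₂ v k = D.lap₁ v k ∧
      sin W.κ * W.netCur₁ v k + cos W.κ * W.netCur₂ v k = D.lap₂ v k := by
  have sc := sin_sq_add_cos_sq W.κ
  have h1 : cos W.κ * W.netCur₁ v k - sin W.κ * W.netCur₂ v k = ∑ j, lapMat D k j * v.1 j := by
    simp only [netCur₁, netCur₂, hYre, hYim, Finset.mul_sum, ← Finset.sum_sub_distrib]
    refine Finset.sum_congr rfl fun j _ => ?_
    linear_combination (lapMat D k j * v.1 j) * sc
  have h2 : sin W.κ * W.netCur₁ v k + cos W.κ * W.netCur₂ v k = ∑ j, lapMat D k j * v.2 j := by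
    simp only [netCur₁, netCur₂, hYre, hYim, Finset.mul_sum, ← Finset.sum_add_distrib]
    refine Finset.sum_congr rfl fun j _ => ?_
    linear_combination (lapMat D k j * v.2 j) * sc
  refine ⟨?_, ?_⟩
  · rw [h1, sum_lapMat_mul]; rfl
  · rw [h2, sum_lapMat_mul]; rfl

/-! ## §2 The field identity under (H-Y) + (H-pq) -/

/-- **RULING 18 / A20 in the kernel: `f^s_v̂` (Subotić et al. (ss.f.vhat), set-point/admittance
form, `DvocNetwork.field`) = (17) (Groß et al., phase-error form, `DvocReduced.field`).**
Hypotheses: equal gains `η`, `η_a = α`, equal magnitude set-points `v_k* ≠ 0`; (H-Y)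
`ℛ(κ) i^s_o(v) = 𝓛 v` [cite: GrossEtAl2019, Assumption 1]; (H-pq) consistent set-points
`p_k* = Σ_j p_jk*(κ)`, `q_k* = Σ_j q_jk*(κ)` [cite: GrossEtAl2019, Condition 1 with (36)]. Proof =
lit-2's `Kpq_apply_eq_Kang_apply` ((37), Prop. 1) + `eθ_eq_K_sub_lap` (ColombinoEtAl2019 Prop. 1)
+ `Φ_k` agreement. MODELLED column; no stability claim. -/
theorem field_eq_reduced_field (W : DvocNetwork N) (D : DvocReduced N)
    (hη : W.η = D.η) (hα : W.ηa = D.α) (hvref : W.vref = D.vref) (hv : ∀ k, D.vref k ≠ 0)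
    (hY : ∀ v k, cos W.κ * W.netCur₁ v k - sin W.κ * W.netCur₂ v k = D.lap₁ v k ∧
      sin W.κ * W.netCur₁ v k + cos W.κ * W.netCur₂ v k = D.lap₂ v k)
    (hpq : ∀ k, W.pref k = D.pSet W.κ k ∧ W.qref k = D.qSet W.κ k) :
    W.field = D.field := by
  funext v
  refine Prod.ext (funext fun k => ?_) (funext fun k => ?_)
  · -- first components: `η[(K v)_1 − (R(κ) i)_1 + η_a Φ x] = η[e_θ,1 + α Φ x]`
    have hvk : W.vref k = D.vref k := by rw [hvref]
    have hKv : (W.unit k).Kv₁ (v.1 k) (v.2 k) = D.Kang₁ v k := by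
      rw [← (D.Kpq_apply_eq_Kang_apply W.κ v (hv k)).1]
      show 1 / W.vref k ^ 2 * (cos W.κ * (W.pref k * v.1 k + W.qref k * v.2 k)
          - sin W.κ * (-(W.qref k * v.1 k) + W.pref k * v.2 k))
        = 1 / D.vref k ^ 2 * (cos W.κ * (D.pSet W.κ k * v.1 k + D.qSet W.κ k * v.2 k)
          - sin W.κ * (-(D.qSet W.κ k * v.1 k) + D.pSet W.κ k * v.2 k))
      rw [hvk, (hpq k).1, (hpq k).2]
    have hΦ : (W.unit k).phi (v.1 k) (v.2 k) = D.Phi v k := by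
      show 1 - (v.1 k ^ 2 + v.2 k ^ 2) / W.vref k ^ 2
        = (D.vref k ^ 2 - (v.1 k ^ 2 + v.2 k ^ 2)) / D.vref k ^ 2
      rw [hvk, sub_div, div_self (pow_ne_zero 2 (hv k))]
    have e1 : W.dv₁ v k = W.η * ((W.unit k).Kv₁ (v.1 k) (v.2 k)
        - (cos W.κ * W.netCur₁ v k - sin W.κ * W.netCur₂ v k)
        + W.ηa * (W.unit k).phi (v.1 k) (v.2 k) * v.1 k) := rfl
    show W.dv₁ v k = D.η * (D.eθ₁ v k + D.α * D.Phi v k * v.1 k)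
    rw [e1, hKv, (hY v k).1, hΦ, hη, hα, D.eθ₁_eq_K_sub_lap]
  · -- second components
    have hvk : W.vref k = D.vref k := by rw [hvref]
    have hKv : (W.unit k).Kv₂ (v.1 k) (v.2 k) = D.Kang₂ v k := by
      rw [← (D.Kpq_apply_eq_Kang_apply W.κ v (hv k)).2]
      show 1 / W.vref k ^ 2 * (sin W.κ * (W.pref k * v.1 k + W.qref k * v.2 k)
          + cos W.κ * (-(W.qref k * v.1 k) + W.pref k * v.2 k))
        = 1 / D.vref k ^ 2 * (sin W.κ * (D.pSet W.κ k * v.1 k + D.qSet W.κ k * v.2 k)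
          + cos W.κ * (-(D.qSet W.κ k * v.1 k) + D.pSet W.κ k * v.2 k))
      rw [hvk, (hpq k).1, (hpq k).2]
    have hΦ : (W.unit k).phi (v.1 k) (v.2 k) = D.Phi v k := by
      show 1 - (v.1 k ^ 2 + v.2 k ^ 2) / W.vref k ^ 2
        = (D.vref k ^ 2 - (v.1 k ^ 2 + v.2 k ^ 2)) / D.vref k ^ 2
      rw [hvk, sub_div, div_self (pow_ne_zero 2 (hv k))]
    have e2 : W.dv₂ v k = W.η * ((W.unit k).Kv₂ (v.1 k) (v.2 k)
        - (sin W.κ * W.netCur₁ v k + cos W.κ * W.netCur₂ v k)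
        + W.ηa * (W.unit k).phi (v.1 k) (v.2 k) * v.2 k) := rfl
    show W.dv₂ v k = D.η * (D.eθ₂ v k + D.α * D.Phi v k * v.2 k)
    rw [e2, hKv, (hY v k).2, hΦ, hη, hα, D.eθ₂_eq_K_sub_lap]

/-- Entrywise-data version: `Yre = cos κ · L`, `Yim = −sin κ · L` (Assumption 1) and consistent
set-points (Condition 1) ⇒ the fields agree. [cite: GrossEtAl2019, Assumption 1, Condition 1] -/
theorem field_eq_reduced_field_of_admittance (W : DvocNetwork N) (D : DvocReduced N)
    (hη : W.η = D.η) (hα : W.ηa = D.α) (hvref : W.vref = D.vref) (hv : ∀ k, D.vref k ≠ 0)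
    (hYre : ∀ k j, W.Yre k j = cos W.κ * lapMat D k j)
    (hYim : ∀ k j, W.Yim k j = -(sin W.κ * lapMat D k j))
    (hpq : ∀ k, W.pref k = D.pSet W.κ k ∧ W.qref k = D.qSet W.κ k) :
    W.field = D.field :=
  field_eq_reduced_field W D hη hα hvref hv (rot_netCur_eq_lap W D hYre hYim) hpq

/-! ## §3 Class inclusion: every printed phase-error record is a Summits dVOC network -/

/-- The Summits-side dVOC network carried by a phase-error record `D` of lit-2's typing and a
rotation angle `κ`: gains `(η, η_a, κ) := (η, α, κ)`, set-points `p_k* := Σ_j p_jk*(κ)`,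
`q_k* := Σ_j q_jk*(κ)` (Condition 1, (36)), `v_k*` unchanged, admittance blocks
`𝒴_{kj} := L_{kj} R(−κ)` (`Yre = cos κ · L`, `Yim = −sin κ · L`, Assumption 1).
MODELLED column. [cite: GrossEtAl2019, Assumption 1, Condition 1, eq. (17)] -/
def ofReduced (D : DvocReduced N) (κ : ℝ) : DvocNetwork N where
  η := D.η
  ηa := D.α
  κ := κ
  pref := fun k => D.pSet κ k
  qref := fun k => D.qSet κ k
  vref := D.vref
  Yre := fun k j => cos κ * lapMat D k j
  Yim := fun k j => -(sin κ * lapMat D k j)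

/-- **Class inclusion, hypothesis-free up to `v_k* ≠ 0`**: the reduced model (17) of a record `D`
is LITERALLY the Summits dVOC field of `ofReduced D κ`, for every `κ`. Hence every object on RULING
18's Track T (lit-2/lyap-1/sos-1) is an `InverterDVOCNetwork` object; with `N = 2` the quotient
machinery of `InverterDVOCQuotient.lean` (p467971) applies to it verbatim. [folklore] -/
theorem ofReduced_field (D : DvocReduced N) (κ : ℝ) (hv : ∀ k, D.vref k ≠ 0) :
    (ofReduced D κ).field = D.field :=
  field_eq_reduced_field_of_admittance (ofReduced D κ) D rfl rfl rfl hv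
    (fun _ _ => rfl) (fun _ _ => rfl) (fun _ => ⟨rfl, rfl⟩)

/-! ## §4 Solutions coincide; Proposition 3 along Summits-side solutions -/

/-- Under the field identity the two solution notions (tree convention `HasDerivWithinAt`)
coincide. [folklore] -/
theorem isSolutionOn_iff_reduced {W : DvocNetwork N} {D : DvocReduced N} (h : W.field = D.field)
    (γ : ℝ → State N) (s : Set ℝ) : W.IsSolutionOn γ s ↔ D.IsSolutionOn γ s := by
  simp only [DvocNetwork.IsSolutionOn, DvocReduced.IsSolutionOn, h]

/-- **Proposition 3 of [cite: GrossEtAl2019] (25), read on the Summits-side model.** Under the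
field identity (e.g. (H-Y)+(H-pq), or `W = ofReduced D κ`) and lit-2's hypotheses — gains
`η > 0`, `α ≥ 0`, `v_k* > 0`, margin `c > 0` with the decrease inequality (23) `DecreaseOnS c`
(Lemma 2's conclusion; per instance a PSD certificate), phase-error bound `κ₀ > 0`
(`PhaseErrorBound κ₀`) — along every curve with `HasDerivWithinAt γ (W.field (γ t)) s t` the printed
Lyapunov function (19) with `α₁ = c/(5ηκ₀²)` has a derivative `d ≤ −α₁ψ(γ t)² ≤ 0` within `s` at
`t`. A transport of `DvocReduced.hasDerivWithinAt_V_le` (p475771), nothing re-proved. MODELLED: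
MV-6O (+ MV-κ for instances with a redefined `κ′`). No stability word. [cite: GrossEtAl2019, Prop. 3] -/
theorem hasDerivWithinAt_V_le_of_field_eq [NeZero N] {W : DvocNetwork N} {D : DvocReduced N}
    (h : W.field = D.field) (hη : 0 < D.η) (hα : 0 ≤ D.α) (hv : ∀ k, 0 < D.vref k)
    {c κ₀ : ℝ} (hc : 0 < c) (hκ₀ : 0 < κ₀) (h23 : D.DecreaseOnS c) (hK : D.PhaseErrorBound κ₀)
    {γ : ℝ → State N} {s : Set ℝ} {t : ℝ} (hγ : HasDerivWithinAt γ (W.field (γ t)) s t) :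
    ∃ d : ℝ, HasDerivWithinAt (fun τ => D.V (D.alpha1 c κ₀) (γ τ)) d s t ∧
      d ≤ -(D.alpha1 c κ₀) * D.psi κ₀ (γ t) ^ 2 ∧ d ≤ 0 := by
  rw [h] at hγ
  exact D.hasDerivWithinAt_V_le hη hα hv hc hκ₀ h23 hK hγ

/-- The same for the class-inclusion network `ofReduced D κ` (hypothesis-free field identity).
[cite: GrossEtAl2019, Prop. 3] -/
theorem ofReduced_hasDerivWithinAt_V_le [NeZero N] (D : DvocReduced N) (κ : ℝ)
    (hη : 0 < D.η) (hα : 0 ≤ D.α) (hv : ∀ k, 0 < D.vref k)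
    {c κ₀ : ℝ} (hc : 0 < c) (hκ₀ : 0 < κ₀) (h23 : D.DecreaseOnS c) (hK : D.PhaseErrorBound κ₀)
    {γ : ℝ → State N} {s : Set ℝ} {t : ℝ}
    (hγ : HasDerivWithinAt γ ((ofReduced D κ).field (γ t)) s t) :
    ∃ d : ℝ, HasDerivWithinAt (fun τ => D.V (D.alpha1 c κ₀) (γ τ)) d s t ∧
      d ≤ -(D.alpha1 c κ₀) * D.psi κ₀ (γ t) ^ 2 ∧ d ≤ 0 :=
  hasDerivWithinAt_V_le_of_field_eq (ofReduced_field D κ fun k => (hv k).ne') hη hα hv hc hκ₀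
    h23 hK hγ

end Summit.Ventures.GridStability.Models.InverterDVOC.DvocNetwork

end
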